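import Summits.QuantumFields.BalabanUV.T4Continuum.Spine.NE1p.DressedAttainment

/-!
# T⁴ programme, spine estimate NE1′ (node O3b/H2) — END-F with leaf F-6 READ IN THE CRUDE COMB ROUTE: the fresh-pair
# defect DISAPPEARS into two displayed one-configuration LEVEL-regularity binders on the attaining pair

Cell `pub-balaban`, sub-cell `t4`, NE1′ formalisation swarm `b2b-balaban-t4-ne1p-formalise-*`, seat LEAF PROVER 06
(own-initiative supplier item NE1p-S7b «F6-CRUDE», journal INTENT CLAIMS.log l.8795, under the seat's delivered locator row
S7 «F-6 LOCATOR» — certificate `t4/b2b-balaban-t4-ne1p-formalise-leaf-06/XREAD-F6-rate-B7-B12.md`, `t4/GAPS-T4.md` rows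
C-ne1pleaf06-1…3 / I-ne1pleaf06-1); tree target `Summits/QuantumFields/BalabanUV/T4Continuum/Spine/NE1p/`; ADDITIVE —
imports `Spine/NE1p/DressedAttainment` (hence `DressedRoot`) ONLY, modifies nothing.

WHAT.  END-F `DressedRoot.transportLeaf_of_centredExponent` displays leaf F-6 ((I4′), the TRANSVERSE fresh-defect rate)
through a real datum `defect b k′ k` and three binders: `hdefw : defect ≤ w`, `hrate : defect ≤ c_δ·ψ^{k−k′}` and the
`RelGauge (rel b k′ k) latMove latN U₀ U₁ (defect b k′ k)` clause of the attainment binder `hlin`.  In the CRUDE COMB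
ROUTE of the lineage record (`t4/T4-EST-NE1p-P1.md` §3 (T-⊥-crude); kernel `T4BlockTransport.block_transport_crude` /
`relGauge_crude`, the printed (1.26) mechanism of [Balaban1985RegularSpaces] Lemma 1 as CONTEXT) the defect of a pair of
UNITARY-LIKE configurations is `(d−1)(L_blk−1)·(q₁+q₀)` from the two members' based-plaquette deviations `q₀, q₁` on the
generation's block — NO property of `U₁ − U₀` is used (not its amplitude, not its covariant curl, no commutation of an
averaging with covariant differences).  This file makes that reading kernel-explicit AT THE END-F INTERFACE:
* §1 `hlin_of_crudeAttained` — with `rel b k′ k := BlockRel (Lg b k′) (zg b k′)`, `defect b k′ k := C_*·(a₁+a₀)·ψ^{k−k′}`,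
  `c_δ := C_*·(a₁+a₀)`, the three binders `hdefw` ∕ `hrate` ∕ `hlin` of END-F are PRODUCED AT ONCE from the crude data
  (`0 < ψ ≤ 1`, `0 < a₁ + a₀`, `0 < C_*`, `(d−1)(Lg b k′ − 1) ≤ C_*`, window relation `C_*·(a₁+a₀) ≤ w`) and the CRUDE
  ATTAINMENT binder (booked size attained up to `ε` by the response at a unitary-like pair, base in `𝒦 b k′ k`, two-sided
  based-plaquette deviations `≤ a₁ψ^{k−k′}`, `≤ a₀ψ^{k−k′}` on the block) — `relGauge_crude` BY NAME;
* §2 `transportLeaf_of_centredExponent_crude` — END-F BY NAME with `hinv` := invariance under the block relation and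
  (`hdefw`, `hrate`, `hlin`) REPLACED by the crude data + crude attainment; conclusion = the field type of
  `BookingLeaves.htr` at `C = 4·C_*(a₁+a₀)/r`, `ρ i = ψ·α i`;
* §3 `crudeAttained_of_lin_le_sSup` — the crude attainment itself from the booking convention (`lin ≤ sSup` of the
  increments over the unitary-like two-sided pairs + their non-emptiness; `DressedAttainment.exists_le_add_of_le_sSup`).

CITATION STATUS (trigger c3; the seat's locator).  In this face the wall leaf F-6 is DISPLAYED as two ONE-configuration
level binders on the attaining pair: `PlaqSup (Lg b k′) (zg b k′) (‖plaq U₀ − 1‖) (a₀ψ^{k−k′})` (the base point — printed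
TYPE of the premise: [Balaban1985RegularSpaces] (1.7) p. 77 «|U(∂p) − 1| < α₀L^{−2j} for p ∈ Ω_j», [Balaban1988Convergent]
(2.34)/(2.35) p. 261, [Balaban1987RG1] (1.16) p. 263; never a hypothesis-free fact) and the same for the PARTNER `U₁` with
`a₁` — whose K- and k-free validity for the cell's fluctuation partners is the OPEN item (a) of GAPS-T4 I-ne1pleaf06-1,
asserted NOWHERE.  [folklore] wiring + [arith]; 0 sorry; no `def`; nothing of Bałaban's densities asserted; headline
«L-T ⇐ F-1…F-5, F-7, F-9 + two-sided level regularity of the attaining pairs», never «NE1′ proved».  NE1′ NOT printed,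
NOT proved; spine PROVED 0∕9; rung (B)+1 on ONE finite T⁴ — NOT infinite volume, NOT a mass gap, NOT the Clay problem.
HONEST DEPENDENCY: continuum YM on T⁴ ⇐ BetaPertH ∧ nine spine estimates (0/9 proved); BetaPertH ⇐ (D1) ∧ (D4) ∧
CAP+tail; G-an2-4 gates asym, D1 and NE2/3/4.
-/

noncomputable section

namespace Summit.QuantumFields.BalabanUV.T4Continuum.NE1p.DressedTransportCrude

open MeasureTheory Set Metric
open Literature.MathematicalPhysics.QuantumFieldTheory.Balaban1983to89
open Literature.MathematicalPhysics.QuantumFieldTheory.Balaban1983to89.T4TrajectoryComparison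
open Summit.QuantumFields.BalabanUV.T4Continuum.T4TrajectoryDensityDressed
open T4BirthChartTransport (GaugeInvariant BirthSlice RelGauge)
open T4RelativeLadder (UnitaryLike)
open T4RelativeComb (Cfg plaq PlaqSup)
open T4BlockTransport (Fld NDir val latMove latN BlockRel relGauge_crude)
open T4TrajectoryDensity

variable {B : T4TermFormat.Booking} {T : Trajectory B}
variable {R : Type*} [NormedRing R] {d : ℕ} {F : Type*} [NormedAddCommGroup F]

/-! ## §1 F-6 ∕ F-8 of END-F from the crude data and the crude attainment -/

section CrudeBinders

variable [NormOneClass R] [NormedAlgebra ℂ R]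

/-- **THE CRUDE DEFECT IS INSIDE THE WINDOW** [arith]: `C_*(a₁+a₀)·ψ^{k−k′} ≤ w` from `0 ≤ ψ ≤ 1`, `0 ≤ C_*(a₁+a₀) ≤ w`
— END-F's `hdefw` for `defect b k′ k := C_*(a₁+a₀)·ψ^{k−k′}`. [folklore] -/
theorem crudeDefect_le_window {Cst a ψ w : ℝ} (hψ : 0 ≤ ψ) (hψ1 : ψ ≤ 1) (hCa : 0 ≤ Cst * a) (hw : Cst * a ≤ w)
    (n : ℕ) : Cst * a * ψ ^ n ≤ w :=
  calc Cst * a * ψ ^ n ≤ Cst * a * 1 := mul_le_mul_of_nonneg_left (pow_le_one₀ hψ hψ1) hCa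
    _ ≤ w := by rw [mul_one]; exact hw

/-- **F-8 WITH F-6 IN THE CRUDE READING** [bookkeeping]: if the booked size `T.lin b k′ k` is attained up to every `ε` by
the response of `Fn b k′ k` at a UNITARY-LIKE pair `(U₀, U₁)`, base `val U₀ ∈ 𝒦 b k′ k`, with two-sided based-plaquette
deviations `≤ a₁ψ^{k−k′}`, `≤ a₀ψ^{k−k′}` on the generation's block `B(zg b k′)` of side `Lg b k′`, and the ladder
constant dominates, `(d−1)(Lg b k′−1) ≤ C_*`, THEN END-F's attainment binder `hlin` holds VERBATIM with
`rel b k′ k := BlockRel (Lg b k′) (zg b k′)` and `defect b k′ k := C_*·(a₁+a₀)·ψ^{k−k′}` — the `RelGauge` witness is the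
relative comb gauge (`T4BlockTransport.relGauge_crude` BY NAME); NO property of `U₁ − U₀` enters.  Any `Gate`. [folklore] -/
theorem hlin_of_crudeAttained {Gate : ℕ → Prop} {Fn : B.Birth → ℕ → ℕ → Fld d R → F}
    {Lg : B.Birth → ℕ → ℕ} {zg : B.Birth → ℕ → T4BlockTransport.Site d} {𝒦 : B.Birth → ℕ → ℕ → Set (Fld d R)}
    {a₀ a₁ ψ Cst : ℝ} (hψ : 0 < ψ) (ha : 0 < a₁ + a₀) (hCst : 0 < Cst)
    (hC : ∀ b k', ((d : ℝ) - 1) * ((Lg b k' : ℝ) - 1) ≤ Cst)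
    (hatt : ∀ (b : B.Birth) (k' k : ℕ), B.birthScale b ≤ k' → k' ≤ k → k ≤ B.K → RanBelow Gate k → ∀ ε > 0,
      ∃ U₀ U₁ : Cfg d R, val U₀ ∈ 𝒦 b k' k ∧ (∀ x ν, UnitaryLike (U₀ x ν)) ∧ (∀ x ν, UnitaryLike (U₁ x ν)) ∧
        PlaqSup (Lg b k') (zg b k') (fun y ρ ν => ‖(plaq U₁ y ρ ν : R) - 1‖) (a₁ * ψ ^ (k - k')) ∧
        PlaqSup (Lg b k') (zg b k') (fun y ρ ν => ‖(plaq U₀ y ρ ν : R) - 1‖) (a₀ * ψ ^ (k - k')) ∧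
        T.lin b k' k ≤ ‖Fn b k' k (val U₁) - Fn b k' k (val U₀)‖ + ε) :
    ∀ (b : B.Birth) (k' k : ℕ), B.birthScale b ≤ k' → k' ≤ k → k ≤ B.K → RanBelow Gate k → ∀ ε > 0,
      ∃ U₀ ∈ 𝒦 b k' k, ∃ U₁ : Fld d R,
        RelGauge (BlockRel (Lg b k') (zg b k')) latMove latN U₀ U₁ (Cst * (a₁ + a₀) * ψ ^ (k - k')) ∧
          T.lin b k' k ≤ ‖Fn b k' k U₁ - Fn b k' k U₀‖ + ε := by
  intro b k' k hbk' hk'k hk hran ε hε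
  obtain ⟨U₀, U₁, hU₀𝒦, hU₀, hU₁, hq₁, hq₀, hle⟩ := hatt b k' k hbk' hk'k hk hran ε hε
  refine ⟨val U₀, hU₀𝒦, val U₁, ?_, hle⟩
  have hsum : a₁ * ψ ^ (k - k') + a₀ * ψ ^ (k - k') = (a₁ + a₀) * ψ ^ (k - k') := by ring
  have hq : 0 ≤ a₁ * ψ ^ (k - k') + a₀ * ψ ^ (k - k') := by rw [hsum]; positivity
  refine relGauge_crude hU₀ hU₁ hq₁ hq₀ hq ?_ (by positivity)
  calc ((d : ℝ) - 1) * ((Lg b k' : ℝ) - 1) * (a₁ * ψ ^ (k - k') + a₀ * ψ ^ (k - k'))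
      ≤ Cst * (a₁ * ψ ^ (k - k') + a₀ * ψ ^ (k - k')) := mul_le_mul_of_nonneg_right (hC b k') hq
    _ = Cst * (a₁ + a₀) * ψ ^ (k - k') := by rw [hsum, mul_assoc]

end CrudeBinders

/-! ## §2 END-F BY NAME in the crude reading -/

section EndF

variable [NormOneClass R] [NormedAlgebra ℂ R] [MeasurableSpace R] [NormedSpace ℂ F] [CompleteSpace F]

/-- **END-F WITH LEAF F-6 READ IN THE CRUDE COMB ROUTE** [bookkeeping]: `DressedRoot.transportLeaf_of_centredExponent` with
the gauge relation SPECIALISED to the block relation `BlockRel (Lg b k′) (zg b k′)` of the generation's block and the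
three F-6∕F-8 binders (`hdefw`, `hrate`, `hlin`) REPLACED by the crude data (`0 < ψ ≤ 1`, `0 < a₁ + a₀`, `0 < C_*`,
`(d−1)(Lg b k′−1) ≤ C_*`, `C_*(a₁+a₀) ≤ w`) and the crude attainment `hatt` of §1; every other binder ((w1) `hsl`, H2
`hFn`/`h𝒢`/`hDμ`, (w2-act) `hB`/`hE`, `hP`, (w3)⁺ `hN1`/`hN2`/`hdiam`/`hθ`, (w4) `hdom`, positivity) is END-F's verbatim
with `cδ := C_*·(a₁+a₀)`.  Conclusion: the field type of `BookingLeaves.htr` at `C = 4·C_*(a₁+a₀)/r`, `ρ i = ψ·α i`.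
What is displayed in place of F-6: two ONE-configuration level binders on the attaining pair (printed TYPE for the base
member's premise, [Balaban1985RegularSpaces] (1.7) p.77 / [Balaban1988Convergent] (2.34)–(2.35) p.261 — CONTEXT, never
facts; the partner's is open item (a) of GAPS-T4 I-ne1pleaf06-1). [folklore] -/
theorem transportLeaf_of_centredExponent_crude {Fn : B.Birth → ℕ → ℕ → Fld d R → F}
    {Lg : B.Birth → ℕ → ℕ} {zg : B.Birth → ℕ → T4BlockTransport.Site d} {𝒦 : B.Birth → ℕ → ℕ → Set (Fld d R)}
    {ref : B.Birth → ℕ → Fld d R → Fld d R} {base : B.Birth → ℕ → Fld d R → ℝ}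
    {𝒜 𝒬 : B.Birth → ℕ → Fld d R → Fld d R → ℂ} {q : B.Birth → ℕ → Fld d R → ℂ}
    {μ : B.Birth → ℕ → Measure (Fld d R)} {z₀ : B.Birth → ℕ → Fld d R} {D : B.Birth → ℕ → Set (Fld d R)}
    {a₀ a₁ Cst ψ w r m : ℝ} {s θ : B.Birth → ℕ → ℝ} {α : ℕ → ℝ}
    {ϱ : B.Birth → ℕ → ℕ → ℝ} {S : ℕ → B.Birth → Finset B.Birth}
    (hα : ∀ i, 0 ≤ α i) (hr : 0 < r) (hw : 0 < w)
    (hψ : 0 < ψ) (hψ1 : ψ ≤ 1) (ha : 0 < a₁ + a₀) (hCst : 0 < Cst)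
    (hC : ∀ b k', ((d : ℝ) - 1) * ((Lg b k' : ℝ) - 1) ≤ Cst) (hww : Cst * (a₁ + a₀) ≤ w)
    (hsl : ∀ (b : B.Birth) (k' : ℕ), B.birthScale b ≤ k' → k' ≤ B.K →
      RanBelow (budgetGate T s m S (4 * (Cst * (a₁ + a₀)) / r) (fun i => ψ * α i)) k' →
      BirthSlice (Fn b k' k') latMove latN (𝒦 b k' k') w r (T.gen b k'))
    (hFn : ∀ (b : B.Birth) (k' k : ℕ), B.birthScale b ≤ k' → k' ≤ k → k + 1 ≤ B.K →
      RanBelow (budgetGate T s m S (4 * (Cst * (a₁ + a₀)) / r) (fun i => ψ * α i)) (k + 1) →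
      ∀ U, Fn b k' (k + 1) U =
        wOp (expWeight (base b k) (𝒜 b k + 𝒬 b k)) (μ b k) (z₀ b k) U (fun z => Fn b k' k (U + z)))
    (h𝒢 : ∀ (b : B.Birth) (k' k : ℕ), B.birthScale b ≤ k' → k' ≤ k → k + 1 ≤ B.K →
      RanBelow (budgetGate T s m S (4 * (Cst * (a₁ + a₀)) / r) (fun i => ψ * α i)) (k + 1) →
      ∀ U, (fun z => Fn b k' k (U + z)) ∈ BddClass F (μ b k))
    (hD : ∀ b k, (D b k).Nonempty) (hϱ : ∀ b k' k, 0 < ϱ b k' k)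
    (hB : ∀ (b : B.Birth) (k' k : ℕ), B.birthScale b ≤ k' → k' ≤ k → k + 1 ≤ B.K →
      RanBelow (budgetGate T s m S (4 * (Cst * (a₁ + a₀)) / r) (fun i => ψ * α i)) (k + 1) →
      RealBaseAt (ref b k) (base b k) (𝒜 b k) (μ b k) (𝒦 b k' (k + 1)))
    (hE : ∀ (b : B.Birth) (k' k : ℕ), B.birthScale b ≤ k' → k' ≤ k → k + 1 ≤ B.K →
      RanBelow (budgetGate T s m S (4 * (Cst * (a₁ + a₀)) / r) (fun i => ψ * α i)) (k + 1) →
      ExponentSliceAt (ref b k) (𝒜 b k) (μ b k) latMove latN (𝒦 b k' (k + 1)) w (ϱ b k' k) (s b k))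
    (hP : ∀ (b : B.Birth) (k' k : ℕ), B.birthScale b ≤ k' → k' ≤ k → k + 1 ≤ B.K →
      RanBelow (budgetGate T s m S (4 * (Cst * (a₁ + a₀)) / r) (fun i => ψ * α i)) (k + 1) →
      PertSlice (fun U z => 𝒬 b k U z - q b k U) (μ b k) latMove latN (𝒦 b k' (k + 1)) w (ϱ b k' k)
        (m * ∑ f ∈ S k b, T.envVar (4 * (Cst * (a₁ + a₀)) / r) (fun i => ψ * α i) f k))
    (hDμ : ∀ b k, ∀ᵐ z ∂μ b k, z ∈ D b k)
    (hN1 : ∀ (b : B.Birth) (k' k : ℕ), B.birthScale b ≤ k' → k' ≤ k → k + 1 ≤ B.K →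
      ∀ z ∈ D b k, ∀ U ∈ 𝒦 b k' (k + 1), U + z ∈ 𝒦 b k' k)
    (hN2 : ∀ (b : B.Birth) (k' k : ℕ), B.birthScale b ≤ k' → k' ≤ k → k + 1 ≤ B.K →
      ∀ U₀ ∈ 𝒦 b k' (k + 1), ∀ p : NDir d R, latN p ≤ w → ∀ z' ∈ D b k, latMove U₀ p 1 + z' ∈ 𝒦 b k' k)
    (hdiam : ∀ b k, ∀ z ∈ D b k, ∀ z' ∈ D b k, ∀ x ν, ‖z x ν - z' x ν‖ ≤ θ b k)
    (hθ : ∀ b k, 0 < θ b k ∧ θ b k ≤ w)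
    (hdom : ∀ (b : B.Birth) (k' k : ℕ), B.birthScale b ≤ k' → k' ≤ k → k + 1 ≤ B.K →
      Real.exp 3 * (1 + 4 * θ b k / ϱ b k' k) ≤ α k)
    (hinv : ∀ b k' k, GaugeInvariant (BlockRel (Lg b k') (zg b k')) (Fn b k' k))
    (hatt : ∀ (b : B.Birth) (k' k : ℕ), B.birthScale b ≤ k' → k' ≤ k → k ≤ B.K →
      RanBelow (budgetGate T s m S (4 * (Cst * (a₁ + a₀)) / r) (fun i => ψ * α i)) k → ∀ ε > 0,
      ∃ U₀ U₁ : Cfg d R, val U₀ ∈ 𝒦 b k' k ∧ (∀ x ν, UnitaryLike (U₀ x ν)) ∧ (∀ x ν, UnitaryLike (U₁ x ν)) ∧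
        PlaqSup (Lg b k') (zg b k') (fun y ρ ν => ‖(plaq U₁ y ρ ν : R) - 1‖) (a₁ * ψ ^ (k - k')) ∧
        PlaqSup (Lg b k') (zg b k') (fun y ρ ν => ‖(plaq U₀ y ρ ν : R) - 1‖) (a₀ * ψ ^ (k - k')) ∧
        T.lin b k' k ≤ ‖Fn b k' k (val U₁) - Fn b k' k (val U₀)‖ + ε) :
    T.TransportsFromVar (4 * (Cst * (a₁ + a₀)) / r) (fun i => ψ * α i)
      (budgetGate T s m S (4 * (Cst * (a₁ + a₀)) / r) (fun i => ψ * α i)) :=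
  DressedRoot.transportLeaf_of_centredExponent (rel := fun b k' _ => BlockRel (Lg b k') (zg b k'))
    (defect := fun b k' k => Cst * (a₁ + a₀) * ψ ^ (k - k'))
    hα hr hw hsl hFn h𝒢 hD hϱ hB hE hP hDμ hN1 hN2 hdiam hθ hdom hinv
    (fun _ k' k => crudeDefect_le_window hψ.le hψ1 (by positivity) hww (k - k'))
    (fun _ _ _ _ _ _ => le_rfl)
    (hlin_of_crudeAttained (T := T) hψ ha hCst hC hatt)

end EndF

/-! ## §3 The crude attainment from the booking convention -/

/-- **THE CRUDE ATTAINMENT FROM THE BOOKING CONVENTION** [bookkeeping]: if under the history the admissible unitary-like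
two-sided pairs of §1 EXIST and the booked size `T.lin b k′ k` is at most the supremum of the increments
`‖Fn b k′ k (val U₁) − Fn b k′ k (val U₀)‖` over them (the convention `lin := sSup …` gives equality), then the crude
attainment binder `hatt` of §1∕§2 holds (`DressedAttainment.exists_le_add_of_le_sSup`: no boundedness needed).  Any
`Gate`. [folklore] -/
theorem crudeAttained_of_lin_le_sSup {Gate : ℕ → Prop} {Fn : B.Birth → ℕ → ℕ → Fld d R → F}
    {Lg : B.Birth → ℕ → ℕ} {zg : B.Birth → ℕ → T4BlockTransport.Site d} {𝒦 : B.Birth → ℕ → ℕ → Set (Fld d R)}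
    {a₀ a₁ ψ : ℝ}
    (hne : ∀ (b : B.Birth) (k' k : ℕ), B.birthScale b ≤ k' → k' ≤ k → k ≤ B.K → RanBelow Gate k →
      ∃ U₀ U₁ : Cfg d R, val U₀ ∈ 𝒦 b k' k ∧ (∀ x ν, UnitaryLike (U₀ x ν)) ∧ (∀ x ν, UnitaryLike (U₁ x ν)) ∧
        PlaqSup (Lg b k') (zg b k') (fun y ρ ν => ‖(plaq U₁ y ρ ν : R) - 1‖) (a₁ * ψ ^ (k - k')) ∧
        PlaqSup (Lg b k') (zg b k') (fun y ρ ν => ‖(plaq U₀ y ρ ν : R) - 1‖) (a₀ * ψ ^ (k - k')))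
    (hsup : ∀ (b : B.Birth) (k' k : ℕ), B.birthScale b ≤ k' → k' ≤ k → k ≤ B.K → RanBelow Gate k →
      T.lin b k' k ≤ sSup {x : ℝ | ∃ U₀ U₁ : Cfg d R, val U₀ ∈ 𝒦 b k' k ∧ (∀ x ν, UnitaryLike (U₀ x ν)) ∧
        (∀ x ν, UnitaryLike (U₁ x ν)) ∧
        PlaqSup (Lg b k') (zg b k') (fun y ρ ν => ‖(plaq U₁ y ρ ν : R) - 1‖) (a₁ * ψ ^ (k - k')) ∧
        PlaqSup (Lg b k') (zg b k') (fun y ρ ν => ‖(plaq U₀ y ρ ν : R) - 1‖) (a₀ * ψ ^ (k - k')) ∧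
        x = ‖Fn b k' k (val U₁) - Fn b k' k (val U₀)‖}) :
    ∀ (b : B.Birth) (k' k : ℕ), B.birthScale b ≤ k' → k' ≤ k → k ≤ B.K → RanBelow Gate k → ∀ ε > 0,
      ∃ U₀ U₁ : Cfg d R, val U₀ ∈ 𝒦 b k' k ∧ (∀ x ν, UnitaryLike (U₀ x ν)) ∧ (∀ x ν, UnitaryLike (U₁ x ν)) ∧
        PlaqSup (Lg b k') (zg b k') (fun y ρ ν => ‖(plaq U₁ y ρ ν : R) - 1‖) (a₁ * ψ ^ (k - k')) ∧
        PlaqSup (Lg b k') (zg b k') (fun y ρ ν => ‖(plaq U₀ y ρ ν : R) - 1‖) (a₀ * ψ ^ (k - k')) ∧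
        T.lin b k' k ≤ ‖Fn b k' k (val U₁) - Fn b k' k (val U₀)‖ + ε := by
  intro b k' k hbk' hk'k hk hran ε hε
  obtain ⟨V₀, V₁, hV⟩ := hne b k' k hbk' hk'k hk hran
  have hsne : ({x : ℝ | ∃ U₀ U₁ : Cfg d R, val U₀ ∈ 𝒦 b k' k ∧ (∀ x ν, UnitaryLike (U₀ x ν)) ∧
      (∀ x ν, UnitaryLike (U₁ x ν)) ∧
      PlaqSup (Lg b k') (zg b k') (fun y ρ ν => ‖(plaq U₁ y ρ ν : R) - 1‖) (a₁ * ψ ^ (k - k')) ∧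
      PlaqSup (Lg b k') (zg b k') (fun y ρ ν => ‖(plaq U₀ y ρ ν : R) - 1‖) (a₀ * ψ ^ (k - k')) ∧
      x = ‖Fn b k' k (val U₁) - Fn b k' k (val U₀)‖}).Nonempty :=
    ⟨_, V₀, V₁, hV.1, hV.2.1, hV.2.2.1, hV.2.2.2.1, hV.2.2.2.2, rfl⟩
  obtain ⟨x, ⟨U₀, U₁, h𝒦, hU₀, hU₁, hq₁, hq₀, rfl⟩, hle⟩ :=
    DressedAttainment.exists_le_add_of_le_sSup hsne (hsup b k' k hbk' hk'k hk hran) hε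
  exact ⟨U₀, U₁, h𝒦, hU₀, hU₁, hq₁, hq₀, hle⟩

end Summit.QuantumFields.BalabanUV.T4Continuum.NE1p.DressedTransportCrude

end
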